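import Literature.AlgebraicGeometry.HodgeTheory.DirectImageBaseChangeContinuous
import Literature.AlgebraicGeometry.HodgeTheory.InvariantClassesFromTotalSpaceProofs
import HarnessLib

/-!
# Base change of continuous sections of the espace étalé of `Rᵏ π_* ℂ`; local systems over arbitrary smooth bases

Family `hodge`, layer `Literature/AlgebraicGeometry/HodgeTheory`; theorems only (no definition, no
named fact).

For a family `π : 𝒳 ⟶ S` of `ℂ`-schemes and a morphism of bases `g : S' ⟶ S`, the files
`DirectImageBaseChange` / `DirectImageBaseChangeContinuous` transfer fibre classes DOWN, from the
base-changed family `π' = familyPullback.snd π g : 𝒳 ×_S S' ⟶ S'` to `π`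
(`FiberClass.baseChange π g k : FiberClass π' k → FiberClass π k`). This file supplies the opposite
direction on SECTIONS — the pull-back `g⁻¹σ` of a global section `σ` of `Rᵏ π_* ℂ` (Voisin, *Hodge
Theory II*, §3.1.1: "if `i : Y → X` is a continuous map and `𝓕` is a local system … then `i⁻¹(𝓕)`
is a local system", its sections pulling back) — and removes the separatedness of `S` from the
tree's descent of local triviality along open immersions:

* `tubeBaseChangeMap_surjective`, `isEmbedding_tubeBaseChangeMap`,
  `isHomeomorph_tubeBaseChangeMap` — for `g` an OPEN IMMERSION the projection of tubes
  `π'⁻¹V(ℂ) → π⁻¹(g V)(ℂ)` is a homeomorphism, WITHOUT `IsSeparated S` (the projection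
  `𝒳 ×_S S' ⟶ 𝒳` is an open immersion, so an open embedding on complex points,
  `Motives.AlgPoints.isOpenEmbedding_map_holds`; surjectivity from the universal property on
  `ℂ`-points, `Motives.pullbackOver.pointsEquiv`). Compare `tubeBaseChangeHomeomorph` (chart of a
  local homeomorphism `g(ℂ)`, `S` separated).
* `isCohomologicallyLocallyTrivialOn_range_of_familyPullback_of_isOpenImmersion` — **descent of
  cohomological local triviality along an open immersion of bases, no separatedness of `S`**
  (generalises `isCohomologicallyLocallyTrivialOn_range_of_familyPullback`).
* `isCohomologicallyLocallyTrivialOn_univ_of_isSmoothProjectiveFamily_of_smooth` — **`Rᵏ f_* ℂ` is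
  a local system on all of `S(ℂ)` for a smooth projective family over ANY smooth `ℂ`-scheme `S`**
  (not necessarily separated or quasi-compact: cover `S` by affine opens, Ehresmann over each —
  `isCohomologicallyLocallyTrivialOn_univ_of_smooth` — and descend).
* `FiberClass.exists_section_baseChange` — **pull-back of a continuous section along an ARBITRARY
  morphism of bases**: if `π` is cohomologically locally trivial near `g(S'(ℂ))`, every continuous
  section `σ` of `FiberClass.pt : FiberClass π k → S(ℂ)` lifts to a continuous section `σ'` of
  `FiberClass π' k → S'(ℂ)` with `FiberClass.baseChange π g k ∘ σ' = σ ∘ g(ℂ)` (near `u₀`, `σ` is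
  the local section of a tube class `ζ` over a trivialising `B ∋ g u₀`,
  `FiberClass.eventually_eq_fiberRestrict`, and then `σ'` is the local section of the pulled-back
  tube class `pr^* ζ` over `g⁻¹B`, `map_inv_fiberRestrict_map_tubeBaseChangeMap`). In particular
  (closed immersions `g`) flat sections restrict to sub-varieties of the base.
* `FiberClass.exists_section_familyPullback_of_isOpenImmersion` — the open-immersion case from
  the local triviality of `π'` alone; `FiberClass.exists_section_baseChange_of_isSmoothProjectiveFamily`
  — the case of a smooth projective family over a smooth base, along any `g`.

## References

* [VoisinHodgeII2003] C. Voisin, Hodge Theory and Complex Algebraic Geometry II, CUP 2003, §3.1.1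
  (inverse image of a local system, p. 69), §3.1.2.
* [VoisinHodgeI2002] C. Voisin, Hodge Theory and Complex Algebraic Geometry I, CUP 2002, Thm. 9.3,
  §9.2.1 (the local system `Rᵏ π_* A`).
* [SGA1] A. Grothendieck, M. Raynaud, SGA 1, Exp. XII, Prop. 3.1 (xi) (open immersions analytify
  to open immersions).
-/

noncomputable section

open CategoryTheory AlgebraicGeometry
open _root_.Topology _root_.Filter
open Literature.AlgebraicTopology.SingularHomology

namespace Literature.AlgebraicGeometry.HodgeTheory

section HodgeTheory

variable {𝒳 S S' : Motives.SchemeOver ℂ} (π : 𝒳 ⟶ S) (g : S' ⟶ S)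

/-! ### The tube map of a base change along an open immersion is a homeomorphism -/

/-- The projection of tubes `π'⁻¹V(ℂ) → π⁻¹(g V)(ℂ)` is onto, for EVERY morphism of bases `g`: a
complex point `x` of `𝒳` over `g v`, `v ∈ V`, is the image of the complex point `(x, v)` of
`𝒳 ×_S S'` (universal property of the fibre product on `ℂ`-points, `Motives.pullbackOver.pointsEquiv`;
Hartshorne II.3 Thm. 3.3). [cite: Hartshorne1977, II.3 Thm. 3.3] -/
theorem tubeBaseChangeMap_surjective (V : Set (Motives.ComplexPoints S')) :
    Function.Surjective (tubeBaseChangeMap π g V) := by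
  rintro ⟨x, hx⟩
  obtain ⟨v, hv, hvx⟩ := (mem_tubeOver_iff π).1 hx
  let P : Motives.ComplexPoints (Motives.familyPullback π g) :=
    (Motives.pullbackOver.pointsEquiv π g ℂ).symm ⟨(x, v), hvx.symm⟩
  have hP := (Motives.pullbackOver.pointsEquiv π g ℂ).apply_symm_apply ⟨(x, v), hvx.symm⟩
  have hfst : Motives.AlgPoints.map (Motives.familyPullback.fst π g) P = x :=
    congrArg (fun p => (p.1 : _ × _).1) hP
  have hsnd : Motives.AlgPoints.map (Motives.familyPullback.snd π g) P = v :=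
    congrArg (fun p => (p.1 : _ × _).2) hP
  refine ⟨⟨P, ?_⟩, Subtype.ext ?_⟩
  · rw [mem_tubeOver_iff, hsnd]
    exact hv
  · rw [tubeBaseChangeMap_apply_coe]
    exact hfst

/-- For `g` an open immersion, the projection `𝒳 ×_S S' ⟶ 𝒳` is an open immersion (open immersions
are stable under base change; Hartshorne II Ex. 3.1 / Stacks 01JY). [cite: Hartshorne1977, II.3 Thm. 3.3 and Ex. 4.2] -/
theorem isOpenImmersion_familyPullback_fst_left [IsOpenImmersion g.left] :
    IsOpenImmersion (Motives.familyPullback.fst π g).left :=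
  MorphismProperty.of_isPullback (P := @IsOpenImmersion)
    ((Motives.familyPullback.isPullback π g).map (Over.forget _)).flip ‹_›

/-- For `g` an open immersion, the projection of tubes `π'⁻¹V(ℂ) → π⁻¹(g V)(ℂ)` is a topological
embedding — no separatedness of `S` (the projection `𝒳 ×_S S' ⟶ 𝒳` is an open immersion, hence an
open embedding on complex points, SGA1 XII 3.1 (xi): `Motives.AlgPoints.isOpenEmbedding_map_holds`).
[cite: SGA1, Exp. XII Prop. 3.1 (xi)] -/
theorem isEmbedding_tubeBaseChangeMap [IsOpenImmersion g.left] (V : Set (Motives.ComplexPoints S')) :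
    IsEmbedding (tubeBaseChangeMap π g V) := by
  haveI := isOpenImmersion_familyPullback_fst_left π g
  have hemb : IsOpenEmbedding (Motives.AlgPoints.map (Motives.familyPullback.fst π g) :
      Motives.ComplexPoints (Motives.familyPullback π g) → Motives.ComplexPoints 𝒳) :=
    Motives.AlgPoints.isOpenEmbedding_map_holds _
  have h1 : IsEmbedding (fun x' : tubeOver (Motives.familyPullback.snd π g) V =>
      Motives.AlgPoints.map (Motives.familyPullback.fst π g) x'.1) :=
    hemb.isEmbedding.comp IsEmbedding.subtypeVal
  exact h1.codRestrict (tubeOver π (Motives.AlgPoints.map g '' V)) fun x' =>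
    map_fst_mem_tubeOver_image π g x'.2

/-- **For `g` an open immersion the projection of tubes `π'⁻¹V(ℂ) → π⁻¹(g V)(ℂ)` is a homeomorphism**
(embedding and onto) — the separatedness-free form of `tubeBaseChangeHomeomorph` in the case of an
open immersion; the topological content of "`Rᵏ π'_* ℂ = g⁻¹ Rᵏ π_* ℂ`" for the restriction of a
family to an open of the base. [cite: VoisinHodgeII2003, §3.1.1 (p. 69)] [cite: SGA1, Exp. XII Prop. 3.1 (xi)] -/
theorem isHomeomorph_tubeBaseChangeMap [IsOpenImmersion g.left] (V : Set (Motives.ComplexPoints S')) :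
    IsHomeomorph (tubeBaseChangeMap π g V) :=
  isHomeomorph_iff_isEmbedding_surjective.2
    ⟨isEmbedding_tubeBaseChangeMap π g V, tubeBaseChangeMap_surjective π g V⟩

/-- Hence pull-back of tube classes along the projection of tubes is bijective in every degree,
for `g` an open immersion (a homeomorphism induces isomorphisms on singular cohomology).
[cite: VoisinHodgeII2003, §3.1.1 (p. 69)] [cite: HatcherAT2002, §3.1 p. 198] -/
theorem bijective_map_tubeBaseChangeMap [IsOpenImmersion g.left] (V : Set (Motives.ComplexPoints S'))
    (j : ℕ) : Function.Bijective (singularCohomology.map ℂ ℂ (tubeBaseChangeMap π g V) j) := by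
  let h := (isHomeomorph_tubeBaseChangeMap π g V).homeomorph (tubeBaseChangeMap π g V)
  have hh : (h : C(tubeOver (Motives.familyPullback.snd π g) V,
      tubeOver π (Motives.AlgPoints.map g '' V))) = tubeBaseChangeMap π g V :=
    ContinuousMap.ext fun _ => rfl
  rw [← hh]
  exact ConcreteCategory.bijective_of_isIso (singularCohomology.mapIso ℂ ℂ h j).hom

/-! ### Descent of cohomological local triviality along an open immersion (no separatedness) -/

/-- **Cohomological local triviality descends along an open immersion of bases** — WITHOUT the
separatedness of `S` assumed by `isCohomologicallyLocallyTrivialOn_range_of_familyPullback`. If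
`π' : 𝒳 ×_S S' ⟶ S'`, the base change of `π` along an open immersion `g : S' ⟶ S`, is cohomologically
locally trivial over all of `S'(ℂ)`, then `π` is cohomologically locally trivial over the open
`g(S'(ℂ)) ⊆ S(ℂ)`: `g(ℂ)` is an open embedding, and over `g(B')` restriction to the fibre `X_{g w}`
factors as (pull-back to the tube of `π'` over `B'`, a homeomorphism: `isHomeomorph_tubeBaseChangeMap`)
∘ (restriction to `X'_w`, bijective) ∘ (transfer along `X_{g w} ≅ X'_w`), by the chart-free
naturality `map_inv_fiberRestrict_map_tubeBaseChangeMap`.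
[cite: VoisinHodgeII2003, §3.1.1 (p. 69)] [cite: SGA1, Exp. XII Prop. 3.1 (xi)] -/
theorem isCohomologicallyLocallyTrivialOn_range_of_familyPullback_of_isOpenImmersion
    [IsOpenImmersion g.left]
    (h : IsCohomologicallyLocallyTrivialOn (Motives.familyPullback.snd π g)
      (Set.univ : Set (Motives.ComplexPoints S'))) :
    IsCohomologicallyLocallyTrivialOn π
      (Set.range
        (Motives.AlgPoints.map g : Motives.ComplexPoints S' → Motives.ComplexPoints S)) := by
  have hg : IsOpenEmbedding
      (Motives.AlgPoints.map g : Motives.ComplexPoints S' → Motives.ComplexPoints S) :=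
    Motives.AlgPoints.isOpenEmbedding_map_holds g
  refine ⟨fun t ht W hW ↦ ?_⟩
  obtain ⟨v, rfl⟩ := ht
  have hW' : (Motives.AlgPoints.map g) ⁻¹' W ∈ 𝓝 v :=
    (Motives.AlgPoints.continuous_map g).continuousAt.preimage_mem_nhds hW
  obtain ⟨B', hB'o, hvB', hB'W, -, hbij⟩ := h.exists_nhds_bijective (Set.mem_univ v) _ hW'
  refine ⟨Motives.AlgPoints.map g '' B', hg.isOpenMap _ hB'o, Set.mem_image_of_mem _ hvB', ?_,
    Set.image_subset_range _ _, fun j s hs ↦ ?_⟩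
  · rintro _ ⟨w, hw, rfl⟩
    exact hB'W hw
  · obtain ⟨w, hw, rfl⟩ := hs
    -- `(e_w⁻¹)^* ∘ fiberRestrict π' w ∘ pr^* = fiberRestrict π (g w)` over `g(B')`
    have hcomp : (complexBetti.map (Motives.fiberOverFamilyPullbackIso π g w).inv j) ∘
        (fiberRestrict (Motives.familyPullback.snd π g) hw j) ∘
          (singularCohomology.map ℂ ℂ (tubeBaseChangeMap π g B') j) =
        (fiberRestrict π (Set.mem_image_of_mem _ hw) j :
          singularCohomology ℂ ℂ (tubeOver π (Motives.AlgPoints.map g '' B')) j → _) :=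
      funext fun ζ ↦ map_inv_fiberRestrict_map_tubeBaseChangeMap π g j ζ hw
    have hiso : Function.Bijective
        (complexBetti.map (Motives.fiberOverFamilyPullbackIso π g w).inv j) := by
      refine Function.bijective_iff_has_inverse.2
        ⟨complexBetti.map (Motives.fiberOverFamilyPullbackIso π g w).hom j, fun x ↦ ?_, fun x ↦ ?_⟩
      · exact (Motives.fiberOverFamilyPullbackIso π g w).complexBetti_map_hom_map_inv j x
      · exact (Motives.fiberOverFamilyPullbackIso π g w).complexBetti_map_inv_map_hom j x
    have hB : Function.Bijective (fiberRestrict π (Set.mem_image_of_mem _ hw) j :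
        singularCohomology ℂ ℂ (tubeOver π (Motives.AlgPoints.map g '' B')) j → _) := by
      rw [← hcomp]
      exact (hiso.comp (hbij j hw)).comp (bijective_map_tubeBaseChangeMap π g B' j)
    exact hB

/-! ### `Rᵏ f_* ℂ` is a local system over an ARBITRARY smooth base -/

/-- **`Rᵏ f_* ℂ` is a local system on all of `S(ℂ)` for a smooth projective family over ANY smooth
`ℂ`-scheme `S`** — neither separated nor quasi-compact (compare
`isCohomologicallyLocallyTrivialOn_univ_of_smooth`, which asks both): cohomological local triviality
is local on `S(ℂ)` (`isCohomologicallyLocallyTrivialOn_univ_of_forall_exists`); around a point take an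
AFFINE open `U ⊆ S` (separated and quasi-compact, smooth over `ℂ`), where the restricted family
`𝒳 ×_S U ⟶ U` is again smooth projective (`IsSmoothProjectiveFamily.familyPullback_snd`) hence
cohomologically locally trivial over `U(ℂ)` (Ehresmann: `isCohomologicallyLocallyTrivialOn_univ_of_smooth`),
and descend along the open immersion `U ⟶ S`
(`isCohomologicallyLocallyTrivialOn_range_of_familyPullback_of_isOpenImmersion`). (Voisin I §9.2.1:
"`Rᵏ π_* A` is a local system … the stalk at `t` is canonically isomorphic to `Hᵏ(X_t, A)` by
restriction" — a statement local on the base.) [cite: VoisinHodgeI2002, §9.2.1 (with Thm. 9.3)] -/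
theorem isCohomologicallyLocallyTrivialOn_univ_of_isSmoothProjectiveFamily_of_smooth (f : 𝒳 ⟶ S)
    {n : ℕ} (hf : Motives.IsSmoothProjectiveFamily f n) [Smooth S.hom] :
    IsCohomologicallyLocallyTrivialOn f (Set.univ : Set (Motives.ComplexPoints S)) := by
  refine isCohomologicallyLocallyTrivialOn_univ_of_forall_exists f fun t ↦ ?_
  obtain ⟨U, hU, htU, -⟩ :=
    exists_isAffineOpen_mem_and_subset (U := ⊤) (x := t.pt) trivial
  -- the affine open `U` as a `ℂ`-scheme, and the restricted family
  let SU : Motives.SchemeOver ℂ := Over.mk (U.ι ≫ S.hom)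
  let gU : SU ⟶ S := Over.homMk U.ι
  haveI : IsOpenImmersion gU.left := inferInstanceAs (IsOpenImmersion U.ι)
  haveI : IsAffine SU.left := hU
  haveI : Smooth SU.hom := inferInstanceAs (Smooth (U.ι ≫ S.hom))
  haveI : IsAffineHom SU.hom := isAffineHom_of_isAffine SU.hom
  haveI : IsSeparated SU.hom := IsSeparated.of_isAffineHom SU.hom
  haveI : CompactSpace SU.left := isCompact_univ_iff.mp (isAffineOpen_top SU.left).isCompact
  have hf' : Motives.IsSmoothProjectiveFamily (Motives.familyPullback.snd f gU) n :=
    hf.familyPullback_snd gU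
  have hU' := isCohomologicallyLocallyTrivialOn_univ_of_smooth (Motives.familyPullback.snd f gU) hf'
  refine ⟨_, ?_, isCohomologicallyLocallyTrivialOn_range_of_familyPullback_of_isOpenImmersion f gU hU'⟩
  rw [Motives.AlgPoints.range_map_of_isOpenImmersion_holds gU]
  change t.pt ∈ (U.ι).opensRange
  rw [Scheme.Opens.opensRange_ι]
  exact htU

/-! ### Pull-back of continuous sections along an arbitrary base change -/

variable (k : ℕ)

/-- **Pull-back of a continuous section of the espace étalé along an ARBITRARY morphism of bases.**
Let `π` be cohomologically locally trivial over an open `U ⊆ S(ℂ)` containing `g(S'(ℂ))`, and let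
`σ` be a continuous section of `FiberClass.pt : FiberClass π k → S(ℂ)` (a global section of
`Rᵏ π_* ℂ`). Then `σ` pulls back to a continuous section `σ'` of `FiberClass π' k → S'(ℂ)`,
`π' = familyPullback.snd π g`, whose transfer is `σ ∘ g(ℂ)`: `σ' u = (u, e_u^* σ(g u))` for the fibre
isomorphism `e_u : X'_u ≅ X_{g u}` (`Motives.fiberOverFamilyPullbackIso`). Continuity at `u₀`: over a
trivialising `B ∋ g u₀` the section `σ` is the local section of ONE tube class `ζ`
(`FiberClass.eventually_eq_fiberRestrict`), and then over `g⁻¹B` the map `σ'` is the local section of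
the pulled-back tube class `pr^* ζ` (`map_inv_fiberRestrict_map_tubeBaseChangeMap`). This is the
pull-back `g⁻¹` on sections of the local system `Rᵏ π_* ℂ` (Voisin II §3.1.1), on real carriers; no
hypothesis on `g` (closed immersions: restriction of flat sections to a sub-variety of the base).
[cite: VoisinHodgeII2003, §3.1.1 (p. 69)] [cite: VoisinHodgeI2002, §9.2.1] -/
theorem FiberClass.exists_section_baseChange {U : Set (Motives.ComplexPoints S)}
    (hU : IsCohomologicallyLocallyTrivialOn π U) (hgU : ∀ u, Motives.AlgPoints.map g u ∈ U)
    {σ : Motives.ComplexPoints S → FiberClass π k} (hσ : Continuous σ) (hpt : ∀ s, (σ s).pt = s) :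
    ∃ σ' : Motives.ComplexPoints S' → FiberClass (Motives.familyPullback.snd π g) k,
      Continuous σ' ∧ (∀ u, (σ' u).pt = u) ∧
        ∀ u, FiberClass.baseChange π g k (σ' u) = σ (Motives.AlgPoints.map g u) := by
  set π' := Motives.familyPullback.snd π g with hπ'
  -- the classes of `σ` over `g(ℂ)`, and the candidate section
  let c : ∀ u : Motives.ComplexPoints S', complexBetti (Motives.fiberOver π (Motives.AlgPoints.map g u)) k :=
    fun u => (σ (Motives.AlgPoints.map g u)).clsAt (hpt _)
  let σ' : Motives.ComplexPoints S' → FiberClass π' k := fun u =>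
    ⟨u, complexBetti.map (Motives.fiberOverFamilyPullbackIso π g u).hom k (c u)⟩
  have hΦ : Continuous fun u : Motives.ComplexPoints S' =>
      (⟨Motives.AlgPoints.map g u, c u⟩ : FiberClass π k) := by
    have heq : (fun u : Motives.ComplexPoints S' => (⟨Motives.AlgPoints.map g u, c u⟩ : FiberClass π k)) =
        σ ∘ Motives.AlgPoints.map g := funext fun u => FiberClass.mk_clsAt _ _
    rw [heq]
    exact hσ.comp (Motives.AlgPoints.continuous_map g)
  refine ⟨σ', continuous_iff_continuousAt.2 fun u₀ => ?_, fun _ => rfl, fun u => ?_⟩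
  · -- a trivialising open `B ∋ g u₀` of `π` and the tube class `ζ` of `σ` over it
    obtain ⟨B, hBo, hgB, -, hBU, hbij⟩ := hU.exists_nhds_bijective (hgU u₀) Set.univ univ_mem
    obtain ⟨ζ, -, hζ⟩ :=
      FiberClass.eventually_eq_fiberRestrict π k hU hΦ.continuousAt hBo hBU hgB (hbij k hgB)
    -- the open `V = g⁻¹ B ∋ u₀` and the pulled-back tube class over it
    set V : Set (Motives.ComplexPoints S') := Motives.AlgPoints.map g ⁻¹' B with hVdef
    have hVo : IsOpen V := hBo.preimage (Motives.AlgPoints.continuous_map g)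
    have hgVB : Motives.AlgPoints.map g '' V ⊆ B := by
      rintro _ ⟨v, hv, rfl⟩
      exact hv
    set ζV : singularCohomology ℂ ℂ (tubeOver π' V) k :=
      singularCohomology.map ℂ ℂ (tubeBaseChangeMap π g V) k
        (singularCohomology.map ℂ ℂ (tubeInclusion π hgVB) k ζ) with hζV
    refine FiberClass.continuousAt_of_eventually_eq_tubeSection (Φ := σ') continuousAt_id hVo ζV ?_
    have hV₀ : V ∈ 𝓝 u₀ := hVo.mem_nhds hgB
    filter_upwards [hζ, hV₀] with u hu huV
    obtain ⟨huB, hcu⟩ := hu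
    refine ⟨huV, ?_⟩
    change (⟨u, complexBetti.map (Motives.fiberOverFamilyPullbackIso π g u).hom k (c u)⟩ : FiberClass π' k) =
      ⟨u, fiberRestrict π' huV k ζV⟩
    congr 1
    have key : complexBetti.map (Motives.fiberOverFamilyPullbackIso π g u).inv k
        (fiberRestrict π' huV k ζV) = c u := by
      rw [hζV, map_inv_fiberRestrict_map_tubeBaseChangeMap π g k _ huV, fiberRestrict_map_tubeInclusion,
        hcu]
    rw [← key, (Motives.fiberOverFamilyPullbackIso π g u).complexBetti_map_hom_map_inv]
  · -- the transfer of `σ' u` is `σ (g u)`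
    change (⟨Motives.AlgPoints.map g u, complexBetti.map (Motives.fiberOverFamilyPullbackIso π g u).inv k
        (complexBetti.map (Motives.fiberOverFamilyPullbackIso π g u).hom k (c u))⟩ : FiberClass π k) =
      σ (Motives.AlgPoints.map g u)
    rw [(Motives.fiberOverFamilyPullbackIso π g u).complexBetti_map_inv_map_hom]
    exact FiberClass.mk_clsAt _ _

/-- **Pull-back of a continuous section along an open immersion of bases, from the local
triviality of the restricted family alone** (no separatedness of `S`): for `g : S' ⟶ S` an open
immersion with `π' = familyPullback.snd π g` cohomologically locally trivial over `S'(ℂ)`, every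
continuous section `σ` of `FiberClass π k → S(ℂ)` pulls back to a continuous section `σ'` of
`FiberClass π' k → S'(ℂ)` whose transfer is `σ ∘ g(ℂ)` (descend the local triviality to `π` over
`g(S'(ℂ))`, then `FiberClass.exists_section_baseChange`). [cite: VoisinHodgeII2003, §3.1.1 (p. 69)]
[cite: VoisinHodgeI2002, §9.2.1] -/
theorem FiberClass.exists_section_familyPullback_of_isOpenImmersion [IsOpenImmersion g.left]
    (hU' : IsCohomologicallyLocallyTrivialOn (Motives.familyPullback.snd π g)
      (Set.univ : Set (Motives.ComplexPoints S')))
    {σ : Motives.ComplexPoints S → FiberClass π k} (hσ : Continuous σ) (hpt : ∀ s, (σ s).pt = s) :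
    ∃ σ' : Motives.ComplexPoints S' → FiberClass (Motives.familyPullback.snd π g) k,
      Continuous σ' ∧ (∀ u, (σ' u).pt = u) ∧
        ∀ u, FiberClass.baseChange π g k (σ' u) = σ (Motives.AlgPoints.map g u) :=
  FiberClass.exists_section_baseChange π g k
    (isCohomologicallyLocallyTrivialOn_range_of_familyPullback_of_isOpenImmersion π g hU')
    (fun u => Set.mem_range_self u) hσ hpt

/-- **Pull-back of a flat section of a smooth projective family over a smooth base, along ANY
morphism of bases** (`Rᵏ π_* ℂ` is then a local system on all of `S(ℂ)`,
`isCohomologicallyLocallyTrivialOn_univ_of_isSmoothProjectiveFamily_of_smooth`).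
[cite: VoisinHodgeII2003, §3.1.1 (p. 69)] [cite: VoisinHodgeI2002, §9.2.1 (with Thm. 9.3)] -/
theorem FiberClass.exists_section_baseChange_of_isSmoothProjectiveFamily {n : ℕ}
    (hπ : Motives.IsSmoothProjectiveFamily π n) [Smooth S.hom]
    {σ : Motives.ComplexPoints S → FiberClass π k} (hσ : Continuous σ) (hpt : ∀ s, (σ s).pt = s) :
    ∃ σ' : Motives.ComplexPoints S' → FiberClass (Motives.familyPullback.snd π g) k,
      Continuous σ' ∧ (∀ u, (σ' u).pt = u) ∧
        ∀ u, FiberClass.baseChange π g k (σ' u) = σ (Motives.AlgPoints.map g u) :=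
  FiberClass.exists_section_baseChange π g k
    (isCohomologicallyLocallyTrivialOn_univ_of_isSmoothProjectiveFamily_of_smooth π hπ)
    (fun _ => Set.mem_univ _) hσ hpt

end HodgeTheory

end Literature.AlgebraicGeometry.HodgeTheory

end
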